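import Summits.BirchSwinnertonDyer.Rank1Residual.Additive.TameBranchKatoDivisibility
import HarnessLib

/-!
# Delbourgo 2002, Theorem (C) in the tame-branch currency — CONSEQUENCES: rank one (and zero) on the
# whole potentially-ordinary additive locus — Schneider's conjecture for Delbourgo's height PROVED from
# ONE certified tame branch, the valuation identity modulo `μ`, the LOWER half from one regulator
# valuation, class forms on X4♯(G-ord) / X3♯(G-ord) (EVERY defect, NO image hypothesis), the (M) twin,
# and the census join on X4-3 (sub-cell additive-p2, gen 20; cell `b2b-bsdres`)

HONEST FRAMING (cell `b2b-bsdres`, run/shared/lean/b2b/bsd-rank1-residual/, verbatim in every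
file): the goal of the cell is to DELETE the COMBINATION-SHAPED residual classes of the
Birch–Swinnerton-Dyer formula for ALL analytic-rank `≤ 1` elliptic curves over `ℚ` — "full BSD
formula for every rank `≤ 1` curve in class `C`" assembled STRICTLY from published theorems — so
that the rank-`≤ 1` remainder becomes exactly the CONSTRUCTION-SHAPED classes, which are TYPED
(missing-input `Prop`s), NOT attempted. This is not "finishing BSD". Research route on the
CONSTRUCTION-SHAPED classes X3♯(G-ord) / X4♯(G-ord) (and, formally, the (M) rows): labels UNCHANGED,
NOTHING booked, no named fact, no definition; theorems only; every published input is an explicit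
binder (A175 = `Delbourgo2002.mainTheorem` (A)+(B), or `mainTheorem_potMult`; GZK; the typed Kato half
`TameBranchRatDvdAt` of the companion file = Delbourgo 2002 Theorem (C) in E-normalisation, see its
module docstring for the verbatim print and the identification `B_E = c·(L_p^{an})^Δ`).

## What

The companion `TameBranchKatoDivisibility.lean` discharges n1011-p01's λ-certificate `CharLamLeAt W p n`
from the typed Kato half + ONE `p`-integral tame branch with a unit coefficient at index `≤ n`. Here the
consumers of `GordCycRankOneLambda.lean` fire with that certificate DISCHARGED:
* §5 cell-agnostic: `schneider_and_finite_of_tameBranchRatDvdAt_of_cert` (Reg_p(E,Dh) ≠ 0 for EVERY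
  (B)-datum, `#Ш[p^∞] < ∞`), `padicVal_identity_of_tameBranchRatDvdAt_of_cert`
  (`ord Ш[p^∞] + ord Reg_p + ord ∏c + ord ℓ = μ(fE) + rank + 2 ord #tors` — the RATIONAL (C) leaves
  exactly `μ ≥ 0` free), the LOWER half `Typed.MissingLowerBoundAt` from ONE regulator valuation
  (`…_of_regulatorCertificate`) or from the typed cyclotomic lower bound (`…_of_cycLowerBound`);
  class forms: `TypeGOrd.schneider_of_tameBranchRatDvdAt_of_cert` (the (G)-ordinary cell, every defect,
  `p ≥ 5`, non-CM), `TypeGOrd.exists_leadingTermClauses_and_schneider_…` (Delbourgo's own datum),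
  `ClassX4Gord.schneider_rankOne_…` / `ClassX3Gord.schneider_rankOne_…` (`r_an = 1`, certificate
  `‖[T¹]B‖_p = 1`), `ClassX4Gord/ClassX3Gord.missingLowerBoundAt_…_of_regulatorCertificate`, and the
  (M) twin `schneider_of_potMult_…` (every odd `p`).
* §6 the census join on X4-3 (defect `3,4,6`): `CensusX43.OrdinaryTwistPartnerAt` +
  `PlusSymbolsPIntegralAt` + a first-unit-index certificate ⟹ `CharLamLeAt W p n`
  (`charLamLeAt_of_tameBranchRatDvdAt_of_ordinaryTwistPartnerAt`); at `r_an = 1` Schneider for every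
  (B)-datum and for Delbourgo's own (`exists_schneider_rankOne_…_of_ordinaryTwistPartnerAt`) — the
  typeG twin of gen 19's ONE-NUMBER certificate on defect 2 (`BranchUnitCertificateAt`), IMAGE-FREE;
  W1's forthcoming `(μ^an, λ^an)` column per typeG row (rmap-2 GEN 8 (c)(i)) is this certificate's input.

What is NOT claimed: any `μ`-statement or UPPER half (rational divisibility is blind to `μ`); the
tame branch's existence off the census locus; any booking. X3♯(G-ord)/X4♯(G-ord) stay
CONSTRUCTION-SHAPED.

References: [Delbourgo2002] Thm. (A)–(D) (p. 40), §3 pp. 58–60; [Washington1997] §7.1;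
[Miller2011LMS] Def. 1.1; `Additive/GordCycRankOneLambda.lean` (n1011-p01); `Additive/TameBranch*.lean`
(cc-typer-2); `Additive/GordRankOneKatoCertificate*.lean` (this seat, gen 19).
-/

noncomputable section

open scoped Classical MatrixGroups ModularForm NumberField

open CongruenceSubgroup WeierstrassCurve NumberField Literature.NumberTheory.EllipticCurves
  Literature.NumberTheory.EllipticCurves.ModularForms
  Literature.NumberTheory.EllipticCurves.Rank1Residual
  Literature.NumberTheory.EllipticCurves.Rank1Residual.Typed
  Literature.NumberTheory.EllipticCurves.Delbourgo2002
  Literature.NumberTheory.EllipticCurves.GreenbergVatsal2000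
  Summit.BirchSwinnertonDyer.Rank1Residual.X1.MuLambda
  Summit.BirchSwinnertonDyer.Rank1Residual.X1.ParitySqueeze
  Summit.BirchSwinnertonDyer.Rank1Residual.X11a.LambdaNorm
  IsDedekindDomain

namespace Summit.BirchSwinnertonDyer.Rank1Residual.Additive

variable {W : WeierstrassCurve ℚ} [W.IsElliptic] [W.IsGloballyMinimal] {p : ℕ} [hp : Fact p.Prime]

/-! ### §5 Rank one (and rank zero) on the potentially-ordinary locus: Schneider PROVED, the identity
modulo `μ`, the LOWER half from one regulator valuation — every defect, no image hypothesis -/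

/-- **Cell-agnostic core.** `p ≠ 2`, `E = W` additive of type (M) or (G-ord) at `p`; the typed Kato
half `TameBranchRatDvdAt W p`; a tame-branch tuple `(f, ε, α, B)` with `B` `p`-integral and a unit
coefficient at some index `≤ rank_ℤ E(ℚ)` (`hcert`: "`λ^{an} ≤ rank`"); Delbourgo 2002 (B) for the
height datum `Dh` (`hBcl`) and (A)-torsion (`hA`). Then **`Reg_p(E,Dh) ≠ 0` (Schneider, PROVED) and
`Ш(E/ℚ)[p^∞]` is finite** — n1011-p01's `schneider_and_finite_of_charLamLe` with its λ-certificate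
DISCHARGED by §4. Delbourgo's (D) "`ord_{s=0} ≥ r_E`" becomes an EQUALITY of orders and of `λ`.
[cite: Delbourgo2002, Theorem (A), (B), (C) (p. 40)] [cite: Washington1997, §7.1] -/
theorem schneider_and_finite_of_tameBranchRatDvdAt_of_cert (hT : TameBranchRatDvdAt W p)
    {N : ℕ} [NeZero N] {f : CuspForm (Gamma0 N) 2} {ε : DirichletCharacter ℂ_[p] p} {α : ℚ_[p]}
    {B : PowerSeries ℚ_[p]}
    (hp2 : p ≠ 2) (hadd : Addv W p) (hloc : PotMult W p ∨ TypeGOrd W p)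
    (hf : IsNewformOf W f) (hε : orderOf ε = tameDefect W p) (hα : ‖α‖ = 1)
    (hB : IsTameBranchOf f p ε α B) (hint : ∀ j : ℕ, ‖PowerSeries.coeff j B‖ ≤ 1)
    (hcert : ∃ n ≤ W.mordellWeilRank, ‖PowerSeries.coeff n B‖ = 1)
    {Dh : PAdicHeightData W p} (hBcl : LeadingTermClauses W p Dh)
    (hA : ∀ (κ : ZpExtension ℚ p) (γ : Field.absoluteGaloisGroup ℚ),
      κ.IsCyclotomic → κ.IsTopGenerator γ → ∀ D : W.SelmerDualData κ γ, D.IsTorsion) :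
    SchneiderConjecture Dh ∧ Finite (AddCommGroup.primaryComponent W.sha p) := by
  obtain ⟨n, hn, hunit⟩ := hcert
  exact schneider_and_finite_of_charLamLe W p hBcl hA
    ((charLamLeAt_of_tameBranchRatDvdAt_of_integral_of_norm_coeff_eq_one hT hp2 hadd hloc hf hε hα hB
      hint hunit).mono hn)

/-- **The valuation identity at a certified pair, `μ` carried** (cell-agnostic; per cyclotomic
datum). Same inputs, `p ≠ 2`, `X` torsion with generator `fE`: `λ(fE) = rank`, `ord_T fE = rank`,
Schneider, `#Ш[p^∞] < ∞`, and
`ord_p #Ш(E)[p^∞] + ord_p Reg_p(E,Dh) + ord_p ∏c_ℓ + ord_p ℓ = μ(fE) + rank + 2·ord_p #E(ℚ)_tors`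
(`ℓ ∣ p²`, `= 1` off the anomalous rows) — n1011-p01's `padicVal_identity_of_charLamLe`, certificate
discharged. The RATIONAL (C) leaves exactly `μ(fE) ≥ 0` undetermined: `BSD(E,p)` at such a pair is the
statement "`μ(X(E/ℚ_∞)) = ord_p(ℓ·Reg_p(Dh)·q) − rank`" (`L^{(r)}(E,1)/r! = q·Ω_E·Reg_∞`).
[cite: Delbourgo2002, Theorem (B), (C) (p. 40)] [cite: Washington1997, §7.1] -/
theorem padicVal_identity_of_tameBranchRatDvdAt_of_cert (hT : TameBranchRatDvdAt W p)
    {N : ℕ} [NeZero N] {f : CuspForm (Gamma0 N) 2} {ε : DirichletCharacter ℂ_[p] p} {α : ℚ_[p]}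
    {B : PowerSeries ℚ_[p]}
    (hp2 : p ≠ 2) (hadd : Addv W p) (hloc : PotMult W p ∨ TypeGOrd W p)
    (hf : IsNewformOf W f) (hε : orderOf ε = tameDefect W p) (hα : ‖α‖ = 1)
    (hB : IsTameBranchOf f p ε α B) (hint : ∀ j : ℕ, ‖PowerSeries.coeff j B‖ ≤ 1)
    (hcert : ∃ n ≤ W.mordellWeilRank, ‖PowerSeries.coeff n B‖ = 1)
    {Dh : PAdicHeightData W p} (hBcl : LeadingTermClauses W p Dh)
    {κ : ZpExtension ℚ p} {γ : Field.absoluteGaloisGroup ℚ}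
    (hκ : κ.IsCyclotomic) (hγ : κ.IsTopGenerator γ) (hcv : IsCyclotomicVariable p γ)
    (D : W.SelmerDualData κ γ) [Module.Finite (IwasawaAlgebra p) D.X]
    {fE : IwasawaAlgebra p} (hchar : D.charIdeal = Ideal.span {fE}) :
    SchneiderConjecture Dh ∧ Finite (AddCommGroup.primaryComponent W.sha p) ∧
      lam fE = W.mordellWeilRank ∧
      ∃ ℓ : ℕ, ℓ ∣ p ^ 2 ∧ (ReductionNonAnomalous W p → ℓ = 1) ∧
        (padicValNat p (Nat.card (AddCommGroup.primaryComponent W.sha p)) : ℤ) +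
            (padicRegulator Dh).valuation + padicValNat p W.tamagawaProduct + padicValNat p ℓ =
          mu fE + W.mordellWeilRank + 2 * padicValNat p W.torsionOrder := by
  obtain ⟨n, hn, hunit⟩ := hcert
  have hX : D.IsTorsion := isTorsion_of_tameBranchRatDvdAt hT hp2 hadd hloc hf hε hα hB hκ hγ hcv D
  exact padicVal_identity_of_charLamLe W p hBcl hp2 hκ hγ hcv D hX hchar
    (((charLamLeAt_of_tameBranchRatDvdAt_of_integral_of_norm_coeff_eq_one hT hp2 hadd hloc hf hε hα hB
      hint hunit).mono hn) κ γ hκ hγ hcv D fE hchar)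

/-- **The LOWER half of BSD_p from ONE regulator valuation** (cell-agnostic; `r_an ≤ 1`, non-anomalous
rows). Inputs as above plus Gross–Zagier–Kolyvagin (only for `#Ш < ∞`), `#Ш(E)_an = s`, and the
computed inequality `ord_p Reg_p(E,Dh) + ord_p s + ord_p ∏c_ℓ ≤ rank + 2·ord_p #E(ℚ)_tors` (the
BSD-predicted valuation of Delbourgo's regulator when `μ = 0`) ⟹ `Typed.MissingLowerBoundAt W p` —
n1011-p01's `missingLowerBoundAt_of_charLamLe_of_regulatorCertificate`, its λ-certificate and torsion
binders DISCHARGED. NO main conjecture, NO image hypothesis, every defect.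
[cite: Delbourgo2002, Theorem (A), (B), (C) (p. 40)] [cite: Miller2011LMS, Def. 1.1] -/
theorem missingLowerBoundAt_of_tameBranchRatDvdAt_of_cert_of_regulatorCertificate
    (hT : TameBranchRatDvdAt W p)
    {N : ℕ} [NeZero N] {f : CuspForm (Gamma0 N) 2} {ε : DirichletCharacter ℂ_[p] p} {α : ℚ_[p]}
    {B : PowerSeries ℚ_[p]}
    (hp2 : p ≠ 2) (hadd : Addv W p) (hloc : PotMult W p ∨ TypeGOrd W p)
    (hf : IsNewformOf W f) (hε : orderOf ε = tameDefect W p) (hα : ‖α‖ = 1)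
    (hB : IsTameBranchOf f p ε α B) (hint : ∀ j : ℕ, ‖PowerSeries.coeff j B‖ ≤ 1)
    (hcert : ∃ n ≤ W.mordellWeilRank, ‖PowerSeries.coeff n B‖ = 1)
    {Dh : PAdicHeightData W p} (hBcl : LeadingTermClauses W p Dh)
    (hA : ∀ (κ : ZpExtension ℚ p) (γ : Field.absoluteGaloisGroup ℚ),
      κ.IsCyclotomic → κ.IsTopGenerator γ → ∀ D : W.SelmerDualData κ γ, D.IsTorsion)
    (hGZK : rank_eq_analyticRank_of_analyticRank_le_one) (hr : W.analyticRank ≤ 1)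
    (hna : ReductionNonAnomalous W p) {s : ℚ} (hs : shaAn W = (s : ℂ))
    (hreg : (padicRegulator Dh).valuation + padicValRat p s + padicValNat p W.tamagawaProduct ≤
      (W.mordellWeilRank : ℤ) + 2 * padicValNat p W.torsionOrder) :
    MissingLowerBoundAt W p := by
  obtain ⟨n, hn, hunit⟩ := hcert
  exact missingLowerBoundAt_of_charLamLe_of_regulatorCertificate W p hBcl hA hGZK hr hp2 hna
    ((charLamLeAt_of_tameBranchRatDvdAt_of_integral_of_norm_coeff_eq_one hT hp2 hadd hloc hf hε hα hB
      hint hunit).mono hn) hs hreg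

/-- **The LOWER half from the typed cyclotomic lower bound, Schneider rider DISCHARGED** (cell-agnostic):
`CycLowerBoundAt W p Dh` (the main-conjecture-direction input of `GordCycLowerBound.lean`) + Delbourgo
2002 (A)+(B) for `Dh` + the typed Kato half with a certified tame branch + GZK + `r_an ≤ 1` +
non-anomalous ⟹ `Typed.MissingLowerBoundAt W p` — n1011-p01's
`missingLowerBoundAt_of_cycLowerBound_of_charLamLe` with the λ-certificate discharged.
[cite: Delbourgo2002, Theorem (A), (B), (C) (p. 40)] [cite: Miller2011LMS, Def. 1.1] -/
theorem missingLowerBoundAt_of_tameBranchRatDvdAt_of_cert_of_cycLowerBound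
    (hT : TameBranchRatDvdAt W p)
    {N : ℕ} [NeZero N] {f : CuspForm (Gamma0 N) 2} {ε : DirichletCharacter ℂ_[p] p} {α : ℚ_[p]}
    {B : PowerSeries ℚ_[p]}
    (hp2 : p ≠ 2) (hadd : Addv W p) (hloc : PotMult W p ∨ TypeGOrd W p)
    (hf : IsNewformOf W f) (hε : orderOf ε = tameDefect W p) (hα : ‖α‖ = 1)
    (hB : IsTameBranchOf f p ε α B) (hint : ∀ j : ℕ, ‖PowerSeries.coeff j B‖ ≤ 1)
    (hcert : ∃ n ≤ W.mordellWeilRank, ‖PowerSeries.coeff n B‖ = 1)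
    {Dh : PAdicHeightData W p} (hBcl : LeadingTermClauses W p Dh)
    (hA : ∀ (κ : ZpExtension ℚ p) (γ : Field.absoluteGaloisGroup ℚ),
      κ.IsCyclotomic → κ.IsTopGenerator γ → ∀ D : W.SelmerDualData κ γ, D.IsTorsion)
    (hGZK : rank_eq_analyticRank_of_analyticRank_le_one) (hr : W.analyticRank ≤ 1)
    (hna : ReductionNonAnomalous W p) (hlow : CycLowerBoundAt W p Dh) :
    MissingLowerBoundAt W p := by
  obtain ⟨n, hn, hunit⟩ := hcert
  exact missingLowerBoundAt_of_cycLowerBound_of_charLamLe W p hBcl hA hGZK hr hna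
    ((charLamLeAt_of_tameBranchRatDvdAt_of_integral_of_norm_coeff_eq_one hT hp2 hadd hloc hf hε hα hB
      hint hunit).mono hn) hlow

/-! #### Class forms on Delbourgo's (G)-ordinary cell (`p ≥ 5`, non-CM; A175 = Delbourgo 2002 (A)+(B)) -/

/-- **The (G)-ORDINARY cell, EVERY defect `e ∈ {2,3,4,6}`, `p ≥ 5`, `E` non-CM: Schneider's conjecture
for EVERY height datum with Delbourgo's (B)-clauses — in particular for Delbourgo's `⟨,⟩_{p,ℚ}` — from
the typed Kato half and ONE certified tame branch (`λ^{an} ≤ rank`).** Named facts: A175 (`hDel`,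
Delbourgo 2002 (A)+(B)); typed: `TameBranchRatDvdAt` (= Delbourgo 2002 (C), module docstring); per
pair: the tuple, integrality, the unit coefficient. NO image hypothesis (covers X4♯(G-ord)'s
non-surjective rows and X3♯(G-ord) alike), NO Kolyvagin, NO main conjecture.
[cite: Delbourgo2002, Theorem (A), (B), (C) (p. 40)] -/
theorem TypeGOrd.schneider_of_tameBranchRatDvdAt_of_cert (hDel : Delbourgo2002.mainTheorem)
    (hT : TameBranchRatDvdAt W p) (hp5 : 5 ≤ p) (hcm : ¬ W.HasCM) (hadd : Addv W p)
    (hG : TypeGOrd W p)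
    {N : ℕ} [NeZero N] {f : CuspForm (Gamma0 N) 2} {ε : DirichletCharacter ℂ_[p] p} {α : ℚ_[p]}
    {B : PowerSeries ℚ_[p]}
    (hf : IsNewformOf W f) (hε : orderOf ε = tameDefect W p) (hα : ‖α‖ = 1)
    (hB : IsTameBranchOf f p ε α B) (hint : ∀ j : ℕ, ‖PowerSeries.coeff j B‖ ≤ 1)
    (hcert : ∃ n ≤ W.mordellWeilRank, ‖PowerSeries.coeff n B‖ = 1)
    {Dh : PAdicHeightData W p} (hBcl : LeadingTermClauses W p Dh) :
    SchneiderConjecture Dh ∧ Finite (AddCommGroup.primaryComponent W.sha p) :=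
  schneider_and_finite_of_tameBranchRatDvdAt_of_cert hT (by omega) hadd (Or.inr hG) hf hε hα hB hint
    hcert hBcl (fun _ _ hκ hγ D ↦ Delbourgo2002.mainTheorem.isTorsion hDel hp5 hcm hadd hG hκ hγ D)

/-- **Same cell: Delbourgo's OWN datum.** There is a height datum with the (B)-clauses AND
non-degenerate: `∃ Dh, LeadingTermClauses W p Dh ∧ Reg_p(E,Dh) ≠ 0` (print: `Dh = ⟨,⟩_{p,ℚ}`).
[cite: Delbourgo2002, Theorem (A), (B), (C) (p. 40)] -/
theorem TypeGOrd.exists_leadingTermClauses_and_schneider_of_tameBranchRatDvdAt_of_cert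
    (hDel : Delbourgo2002.mainTheorem) (hT : TameBranchRatDvdAt W p) (hp5 : 5 ≤ p) (hcm : ¬ W.HasCM)
    (hadd : Addv W p) (hG : TypeGOrd W p)
    {N : ℕ} [NeZero N] {f : CuspForm (Gamma0 N) 2} {ε : DirichletCharacter ℂ_[p] p} {α : ℚ_[p]}
    {B : PowerSeries ℚ_[p]}
    (hf : IsNewformOf W f) (hε : orderOf ε = tameDefect W p) (hα : ‖α‖ = 1)
    (hB : IsTameBranchOf f p ε α B) (hint : ∀ j : ℕ, ‖PowerSeries.coeff j B‖ ≤ 1)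
    (hcert : ∃ n ≤ W.mordellWeilRank, ‖PowerSeries.coeff n B‖ = 1) :
    ∃ Dh : PAdicHeightData W p, LeadingTermClauses W p Dh ∧ SchneiderConjecture Dh := by
  obtain ⟨Dh, hBcl⟩ := Delbourgo2002.mainTheorem.exists_leadingTermClauses hDel hp5 hcm hadd hG
  exact ⟨Dh, hBcl, (TypeGOrd.schneider_of_tameBranchRatDvdAt_of_cert hDel hT hp5 hcm hadd hG hf hε hα
    hB hint hcert hBcl).1⟩

/-- **X4♯(G-ord), EVERY defect, `p ≥ 5`, non-CM, `ord_{s=1} L(E,s) = 1`: Schneider's `Reg_p(E,Dh) ≠ 0`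
for every (B)-datum from the typed Kato half and the rank-one certificate `‖[T¹]B‖_p = 1` on ONE
integral tame branch** (GZK gives `rank = 1`; `B(0) = 0` is automatic from `L(E,1) = 0` and is not even
needed). The IMAGE-FREE, EVERY-DEFECT twin of gen 19's
`ClassX4Gord.schneider_and_padicVal_identity_rankOne_of_katoHalf_of_cert` (defect 2, `ρ̄` onto,
INTEGRAL Kato component, `μ = 0` included); here `μ` stays free.
[cite: Delbourgo2002, Theorem (A), (B), (C) (p. 40)] -/
theorem ClassX4Gord.schneider_rankOne_of_tameBranchRatDvdAt_of_cert (hDel : Delbourgo2002.mainTheorem)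
    (hGZK : rank_eq_analyticRank_of_analyticRank_le_one) (hT : TameBranchRatDvdAt W p)
    (hX : ClassX4Gord W p) (hp5 : 5 ≤ p) (hcm : ¬ W.HasCM) (hr : W.analyticRank = 1)
    {N : ℕ} [NeZero N] {f : CuspForm (Gamma0 N) 2} {ε : DirichletCharacter ℂ_[p] p} {α : ℚ_[p]}
    {B : PowerSeries ℚ_[p]}
    (hf : IsNewformOf W f) (hε : orderOf ε = tameDefect W p) (hα : ‖α‖ = 1)
    (hB : IsTameBranchOf f p ε α B) (hint : ∀ j : ℕ, ‖PowerSeries.coeff j B‖ ≤ 1)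
    (h1 : ‖PowerSeries.coeff 1 B‖ = 1)
    {Dh : PAdicHeightData W p} (hBcl : LeadingTermClauses W p Dh) : SchneiderConjecture Dh := by
  obtain ⟨hmw, -⟩ := hGZK W (by rw [hr])
  have hr1 : W.mordellWeilRank = 1 := by rw [hmw, hr]
  exact (TypeGOrd.schneider_of_tameBranchRatDvdAt_of_cert hDel hT hp5 hcm hX.1.2.1 hX.2 hf hε hα hB hint
    ⟨1, by rw [hr1], h1⟩ hBcl).1

/-- **X3♯(G-ord) twin** (reducible `E[p]`; `p ≥ 5`, non-CM, `r_an = 1`, every defect): Schneider for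
every (B)-datum from the typed Kato half + the rank-one certificate. On X3♯(G-ord) off defect 2 this is
the FIRST route to Schneider in the tree (Wuthrich's Thm. 16 excludes additive `p`; the branch route is
unprinted off defect 2) — now from PRINTED inputs modulo the typing of (C).
[cite: Delbourgo2002, Theorem (A), (B), (C) (p. 40)] -/
theorem ClassX3Gord.schneider_rankOne_of_tameBranchRatDvdAt_of_cert (hDel : Delbourgo2002.mainTheorem)
    (hGZK : rank_eq_analyticRank_of_analyticRank_le_one) (hT : TameBranchRatDvdAt W p)
    (hX : ClassX3Gord W p) (hp5 : 5 ≤ p) (hcm : ¬ W.HasCM) (hr : W.analyticRank = 1)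
    {N : ℕ} [NeZero N] {f : CuspForm (Gamma0 N) 2} {ε : DirichletCharacter ℂ_[p] p} {α : ℚ_[p]}
    {B : PowerSeries ℚ_[p]}
    (hf : IsNewformOf W f) (hε : orderOf ε = tameDefect W p) (hα : ‖α‖ = 1)
    (hB : IsTameBranchOf f p ε α B) (hint : ∀ j : ℕ, ‖PowerSeries.coeff j B‖ ≤ 1)
    (h1 : ‖PowerSeries.coeff 1 B‖ = 1)
    {Dh : PAdicHeightData W p} (hBcl : LeadingTermClauses W p Dh) : SchneiderConjecture Dh := by
  obtain ⟨hmw, -⟩ := hGZK W (by rw [hr])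
  have hr1 : W.mordellWeilRank = 1 := by rw [hmw, hr]
  exact (TypeGOrd.schneider_of_tameBranchRatDvdAt_of_cert hDel hT hp5 hcm hX.1.2 hX.2 hf hε hα hB hint
    ⟨1, by rw [hr1], h1⟩ hBcl).1

/-- **X4♯(G-ord), every defect, `p ≥ 5`, non-CM, `r_an ≤ 1`, NON-ANOMALOUS over the (G)-fields: the
LOWER half `ord_p #Ш_an ≤ ord_p #Ш` from the typed Kato half + a certified tame branch + ONE regulator
valuation** (`ord_p Reg_p(E,Dh) + ord_p #Ш_an + ord_p ∏c ≤ rank + 2 ord_p #tors`). NO main conjecture.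
[cite: Delbourgo2002, Theorem (A), (B), (C) (p. 40)] [cite: Miller2011LMS, Def. 1.1] -/
theorem ClassX4Gord.missingLowerBoundAt_of_tameBranchRatDvdAt_of_cert_of_regulatorCertificate
    (hDel : Delbourgo2002.mainTheorem) (hGZK : rank_eq_analyticRank_of_analyticRank_le_one)
    (hT : TameBranchRatDvdAt W p) (hX : ClassX4Gord W p) (hp5 : 5 ≤ p) (hcm : ¬ W.HasCM)
    (hr : W.analyticRank ≤ 1) (hna : ReductionNonAnomalous W p)
    {N : ℕ} [NeZero N] {f : CuspForm (Gamma0 N) 2} {ε : DirichletCharacter ℂ_[p] p} {α : ℚ_[p]}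
    {B : PowerSeries ℚ_[p]}
    (hf : IsNewformOf W f) (hε : orderOf ε = tameDefect W p) (hα : ‖α‖ = 1)
    (hB : IsTameBranchOf f p ε α B) (hint : ∀ j : ℕ, ‖PowerSeries.coeff j B‖ ≤ 1)
    (hcert : ∃ n ≤ W.mordellWeilRank, ‖PowerSeries.coeff n B‖ = 1)
    {Dh : PAdicHeightData W p} (hBcl : LeadingTermClauses W p Dh) {s : ℚ} (hs : shaAn W = (s : ℂ))
    (hreg : (padicRegulator Dh).valuation + padicValRat p s + padicValNat p W.tamagawaProduct ≤
      (W.mordellWeilRank : ℤ) + 2 * padicValNat p W.torsionOrder) :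
    MissingLowerBoundAt W p :=
  Additive.missingLowerBoundAt_of_tameBranchRatDvdAt_of_cert_of_regulatorCertificate hT (by omega)
    hX.1.2.1 (Or.inr hX.2) hf hε hα hB hint hcert hBcl
    (fun _ _ hκ hγ D ↦ Delbourgo2002.mainTheorem.isTorsion hDel hp5 hcm hX.1.2.1 hX.2 hκ hγ D)
    hGZK hr hna hs hreg

/-- **X3♯(G-ord) twin of the regulator-certificate LOWER half** (every defect, `p ≥ 5`, non-CM,
`r_an ≤ 1`, non-anomalous). [cite: Delbourgo2002, Theorem (A), (B), (C) (p. 40)] [cite: Miller2011LMS, Def. 1.1] -/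
theorem ClassX3Gord.missingLowerBoundAt_of_tameBranchRatDvdAt_of_cert_of_regulatorCertificate
    (hDel : Delbourgo2002.mainTheorem) (hGZK : rank_eq_analyticRank_of_analyticRank_le_one)
    (hT : TameBranchRatDvdAt W p) (hX : ClassX3Gord W p) (hp5 : 5 ≤ p) (hcm : ¬ W.HasCM)
    (hr : W.analyticRank ≤ 1) (hna : ReductionNonAnomalous W p)
    {N : ℕ} [NeZero N] {f : CuspForm (Gamma0 N) 2} {ε : DirichletCharacter ℂ_[p] p} {α : ℚ_[p]}
    {B : PowerSeries ℚ_[p]}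
    (hf : IsNewformOf W f) (hε : orderOf ε = tameDefect W p) (hα : ‖α‖ = 1)
    (hB : IsTameBranchOf f p ε α B) (hint : ∀ j : ℕ, ‖PowerSeries.coeff j B‖ ≤ 1)
    (hcert : ∃ n ≤ W.mordellWeilRank, ‖PowerSeries.coeff n B‖ = 1)
    {Dh : PAdicHeightData W p} (hBcl : LeadingTermClauses W p Dh) {s : ℚ} (hs : shaAn W = (s : ℂ))
    (hreg : (padicRegulator Dh).valuation + padicValRat p s + padicValNat p W.tamagawaProduct ≤
      (W.mordellWeilRank : ℤ) + 2 * padicValNat p W.torsionOrder) :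
    MissingLowerBoundAt W p :=
  Additive.missingLowerBoundAt_of_tameBranchRatDvdAt_of_cert_of_regulatorCertificate hT (by omega)
    hX.1.2 (Or.inr hX.2) hf hε hα hB hint hcert hBcl
    (fun _ _ hκ hγ D ↦ Delbourgo2002.mainTheorem.isTorsion hDel hp5 hcm hX.1.2 hX.2 hκ hγ D)
    hGZK hr hna hs hreg

/-- **The (M) twin** (potentially multiplicative additive `p`, EVERY odd `p`, non-CM): with n1011-p16's
`Delbourgo2002.mainTheorem_potMult` (A)+(B) in place of A175, the typed Kato half and a certified tame
branch (`ε` = the Legendre symbol, `α = a_p(E♭) = ±1`) give Schneider for every (B)-datum. The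
image-free twin of p07/p12's `ClassX4M…`/`ClassX3M…` certificate theorems (INTEGRAL Kato/Wuthrich); the
multiplicative-twist binder `hM` is kept explicit. [cite: Delbourgo2002, Theorem (A), (B), (C) (p. 40)] -/
theorem schneider_of_potMult_of_tameBranchRatDvdAt_of_cert (hDelM : Delbourgo2002.mainTheorem_potMult)
    (hT : TameBranchRatDvdAt W p) (hp2 : p ≠ 2) (hcm : ¬ W.HasCM) (hadd : Addv W p)
    (hj : PotMult W p)
    (hM : ∃ d : ℚ, d ≠ 0 ∧ (W.quadraticTwist d).HasMultiplicativeReductionAtPrime p)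
    {N : ℕ} [NeZero N] {f : CuspForm (Gamma0 N) 2} {ε : DirichletCharacter ℂ_[p] p} {α : ℚ_[p]}
    {B : PowerSeries ℚ_[p]}
    (hf : IsNewformOf W f) (hε : orderOf ε = tameDefect W p) (hα : ‖α‖ = 1)
    (hB : IsTameBranchOf f p ε α B) (hint : ∀ j : ℕ, ‖PowerSeries.coeff j B‖ ≤ 1)
    (hcert : ∃ n ≤ W.mordellWeilRank, ‖PowerSeries.coeff n B‖ = 1)
    {Dh : PAdicHeightData W p} (hBcl : LeadingTermClauses W p Dh) :
    SchneiderConjecture Dh ∧ Finite (AddCommGroup.primaryComponent W.sha p) :=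
  schneider_and_finite_of_tameBranchRatDvdAt_of_cert hT hp2 hadd (Or.inl hj) hf hε hα hB hint hcert hBcl
    (fun _ _ hκ hγ D ↦ Delbourgo2002.mainTheorem_potMult.isTorsion hDelM hp2 hcm hadd hj hM hκ hγ D)

/-! ### §6 The census join on X4-3 (defect `3, 4, 6`): `OrdinaryTwistPartnerAt` + `PlusSymbolsPIntegralAt`
+ a first-unit-index certificate ⟹ the λ-certificate; rank one ⟹ Schneider -/

/-- **JOIN with census X4-3 (typeG rows).** On the X4-3 locus (`p ≥ 5`, `E` additive at `p`, `SubGord`,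
`e ∈ {3,4,6}`) the census input `CensusX43.OrdinaryTwistPartnerAt W p` DELIVERS the tuple
`(ι∘ω^{t(E,p)}, ã, B)` (`exists_isTameBranchOf_of_ordinaryTwistPartnerAt`), `PlusSymbolsPIntegralAt W p`
makes `B` integral, and the certificate "for every such tuple some coefficient of index `≤ n` is a
`p`-adic unit" (read off the Riemann sums of the census symbol `Φ`; W1's forthcoming `(μ^an, λ^an)`
column = `(0, ≤ n)`) gives, with the typed Kato half, `CharLamLeAt W p n`. The typeG twin of gen 19's
ONE-NUMBER certificate on defect 2. Nothing asserted; nothing booked. [cite: Delbourgo2002, Theorem (C) (p. 40)] -/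
theorem charLamLeAt_of_tameBranchRatDvdAt_of_ordinaryTwistPartnerAt (hT : TameBranchRatDvdAt W p)
    (h : CensusX43.OrdinaryTwistPartnerAt W p) (hPI : PlusSymbolsPIntegralAt W p) (h5 : 5 ≤ p)
    (hadd : Addv W p) (hG : SubGord W p) (he : semistabilityIndex W p ∈ ({3, 4, 6} : Finset ℕ))
    {N : ℕ} [NeZero N] {f : CuspForm (Gamma0 N) 2} (hf : IsNewformOf W f)
    {χ : MulChar (ZMod p) ℚ_[p]}
    (hχ : CensusX43.IsTeichmullerPow χ (CensusX43.ordinaryTeichmullerExponent W p)) {n : ℕ}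
    (hcert : ∀ (ã : ℚ_[p]) (B : PowerSeries ℚ_[p]), ‖ã‖ = 1 →
      IsTameBranchOf f p (χ.ringHomComp (algebraMap ℚ_[p] ℂ_[p])) ã B →
        ∃ m ≤ n, ‖PowerSeries.coeff m B‖ = 1) :
    CharLamLeAt W p n := by
  obtain ⟨ã, B, hã, hord, hB, hint⟩ :=
    exists_isTameBranchOf_of_ordinaryTwistPartnerAt W p h5 hG he h hf hχ
  have hp2 : p ≠ 2 := by omega
  have hne2 : semistabilityIndex W p ≠ 2 := by
    simp only [Finset.mem_insert, Finset.mem_singleton] at he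
    omega
  have hGord : TypeGOrd W p :=
    (typeGOrd_iff_typeG_of_semistabilityIndex_ne_two W p h5 hadd hne2).mpr
      ((subGord_iff_typeG_of_addv W p hp2 hadd).mp hG)
  have hint1 : ∀ j : ℕ, ‖PowerSeries.coeff j B‖ ≤ 1 := hint 1 (hPI f hf)
  obtain ⟨m, hm, hunit⟩ := hcert ã B hã hB
  exact (charLamLeAt_of_tameBranchRatDvdAt_of_integral_of_norm_coeff_eq_one hT hp2 hadd (Or.inr hGord)
    hf hord hã hB hint1 hunit).mono hm

/-- **X4-3 locus, `ord_{s=1} L(E,s) = 1`, non-CM: Schneider for Delbourgo's datum** — census input +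
integrality + the rank-one first-unit-index certificate (`‖[T¹]B‖ = 1` for every tuple; the constant
term vanishes with `L(E,1)`) + the typed Kato half + A175 ⟹ for every (B)-datum `Reg_p(E,Dh) ≠ 0`,
and one such datum exists. The rank-one typeG statement the census's D-ii arm is heading for
(rmap-2 GEN 8 (c)(i)); nothing booked. [cite: Delbourgo2002, Theorem (A), (B), (C) (p. 40)] -/
theorem exists_schneider_rankOne_of_tameBranchRatDvdAt_of_ordinaryTwistPartnerAt
    (hDel : Delbourgo2002.mainTheorem) (hGZK : rank_eq_analyticRank_of_analyticRank_le_one)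
    (hT : TameBranchRatDvdAt W p) (h : CensusX43.OrdinaryTwistPartnerAt W p)
    (hPI : PlusSymbolsPIntegralAt W p) (h5 : 5 ≤ p) (hcm : ¬ W.HasCM) (hadd : Addv W p)
    (hG : SubGord W p) (he : semistabilityIndex W p ∈ ({3, 4, 6} : Finset ℕ)) (hr : W.analyticRank = 1)
    {N : ℕ} [NeZero N] {f : CuspForm (Gamma0 N) 2} (hf : IsNewformOf W f)
    {χ : MulChar (ZMod p) ℚ_[p]}
    (hχ : CensusX43.IsTeichmullerPow χ (CensusX43.ordinaryTeichmullerExponent W p))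
    (hcert : ∀ (ã : ℚ_[p]) (B : PowerSeries ℚ_[p]), ‖ã‖ = 1 →
      IsTameBranchOf f p (χ.ringHomComp (algebraMap ℚ_[p] ℂ_[p])) ã B →
        ‖PowerSeries.coeff 1 B‖ = 1) :
    (∀ Dh : PAdicHeightData W p, LeadingTermClauses W p Dh → SchneiderConjecture Dh) ∧
      ∃ Dh : PAdicHeightData W p, LeadingTermClauses W p Dh ∧ SchneiderConjecture Dh := by
  have hp2 : p ≠ 2 := by omega
  have hne2 : semistabilityIndex W p ≠ 2 := by
    simp only [Finset.mem_insert, Finset.mem_singleton] at he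
    omega
  have hGord : TypeGOrd W p :=
    (typeGOrd_iff_typeG_of_semistabilityIndex_ne_two W p h5 hadd hne2).mpr
      ((subGord_iff_typeG_of_addv W p hp2 hadd).mp hG)
  obtain ⟨hmw, -⟩ := hGZK W (by rw [hr])
  have hr1 : W.mordellWeilRank = 1 := by rw [hmw, hr]
  have hlam : CharLamLeAt W p W.mordellWeilRank := by
    rw [hr1]
    exact charLamLeAt_of_tameBranchRatDvdAt_of_ordinaryTwistPartnerAt hT h hPI h5 hadd hG he hf hχ
      fun ã B hã hB ↦ ⟨1, le_rfl, hcert ã B hã hB⟩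
  have hA : ∀ (κ : ZpExtension ℚ p) (γ : Field.absoluteGaloisGroup ℚ),
      κ.IsCyclotomic → κ.IsTopGenerator γ → ∀ D : W.SelmerDualData κ γ, D.IsTorsion :=
    fun _ _ hκ hγ D ↦ Delbourgo2002.mainTheorem.isTorsion hDel h5 hcm hadd hGord hκ hγ D
  have hS : ∀ Dh : PAdicHeightData W p, LeadingTermClauses W p Dh → SchneiderConjecture Dh :=
    fun Dh hBcl ↦ (schneider_and_finite_of_charLamLe W p hBcl hA hlam).1
  obtain ⟨Dh, hBcl⟩ := Delbourgo2002.mainTheorem.exists_leadingTermClauses hDel h5 hcm hadd hGord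
  exact ⟨hS, Dh, hBcl, hS Dh hBcl⟩

end Summit.BirchSwinnertonDyer.Rank1Residual.Additive

end
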